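/-
Copyright (c) 2026 the pub-hodgecm2 formalisation cell (harness21).  New file.
Origin: seat `prover-pub-hodgecm2-item6-p2-g16-0` (unit pub-hodgecm2-item6-p2, TRANSPOSITION item (vi) extra prover p2, gen 16; drafted by
gens 8–11 of the same lineage as `portjoin/Closed.lean.draft` 9f983b4f9aea → `Closed.v2.lean.draft` f4937eceb853; v4 = v3 6f663f4eb272 with the
index namespace corrected to `HodgeCM.Model.LiuIndex` per pin-3 g6's pre-landing read, HOME/INBOX l.8850), 2026-08-22 — PORT JOIN part 3,
the hM ∕ B01 DISCHARGE-BY-RECORD file asked for by the coordinator (BULK PORT LANE ruling, relayed 2026-08-22T14:05:33Z): it consumes BY NAME the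
top of the ported HodgeCM cone, `HodgeCM.Model.periodThmF_picardCM_of_GRU_thm418C` (`Summits/HodgeConjecture/HodgeCM/Model/PeriodThmFFace.lean`,
port layer 96), through PORT JOIN part 2 (`CorCM/PortJoin/PeriodThmF.lean`: the ported model universe IS the tree's, `rfl`) and the tree's E term.
KERNEL only: ONE theorem; ONE displayed hypothesis binder `h418` (a CITED reading, see the docstring); `hGRU` of the ported head is NOT a binder
here — it is the tree theorem `GRConstruction.gru_shape` (`Literature/NumberTheory/GelbartRogawski1991/CompatibleSplittingCM.lean`).  T5: one
displayed Prop binder (FRESH T5 line requested on the exact bytes before filing).  Count-neutral until the referees say otherwise; HC_CM is NOT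
proved by this file: `hc_cm_of_thm418C` is HC_CM MODULO the displayed cite `h418`.
-/
import Summits.HodgeConjecture.HodgeCM.Model.PeriodThmFFace
import Summits.HodgeConjecture.CorCM.PortJoin.PeriodThmF
import Summits.HodgeConjecture.CorCM.Model.CMAbelianVarietyEigenbasisRealisedHolds
import Literature.NumberTheory.GelbartRogawski1991.CompatibleSplittingCM
import HarnessLib

set_option autoImplicit false

/-!
# PORT JOIN part 3 — `PortJoin.hc_cm_of_thm418C`: HC_CM from the ported package head, modulo its one displayed cite `h418`

Lane (α) row D (hM ∕ B01 DISCHARGE-BY-RECORD through the PORT).  ONE theorem, ONE displayed hypothesis binder: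
* `h418` — the combined reading r8 `Thm418C` of [Liu2021, Thm. 4.18] on the pinned dictionary `HodgeCM.Model.liuDictionaryPin` at the tree's
  record rows (STRONGER-IN-X, NOT «Thm 4.18 as printed»; the Δ2 bridge replaces it by the as-printed cites + named pins).
The head's other hypothesis `hGRU` ([GelbartRogawski1991, §3.1 Prop. 3.1.1] in Π-shape) is the tree THEOREM `GRConstruction.gru_shape`;
the head's section Props `hHD ∕ hI ∕ h₁ ∕ h₃` are the tree theorems `exists_isReal_hodgeModel_holds ∕ hodgePQ_independent_of_hodgeModel_holds ∕
BallQuotient.ballQuotientUniformised_holds ∕ cmAbelianVarietyEigenbasisRealised_holds` (axioms trio).  KERNEL: the ported head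
`HodgeCM.Model.periodThmF_picardCM_of_GRU_thm418C` (`HodgeCM/Model/PeriodThmFFace.lean` :179) ⟶ row C `PortJoin.hc_cm_closed_of_pkg_periodThmF`
(`CorCM/PortJoin/PeriodThmF.lean`) ⟶ `HC_CM`.  HC_CM is NOT proved unconditionally: the term is HC_CM MODULO the displayed cite `h418`.
(Bytes: v4 cc0bed774ef6 of the item6-p2 lineage + this module docstring, required by the gate's `lint.import`; the declaration is byte-identical.)
-/

noncomputable section

namespace Summit.HodgeConjecture.CorCM.PortJoin

open Literature.AlgebraicGeometry.HodgeTheory Literature.NumberTheory.Automorphic.PicardCM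
open Literature.NumberTheory.Automorphic Literature.NumberTheory.GelbartRogawski1991 NumberField

/-- **HC_CM from the PORTED package head, modulo its ONE remaining displayed cite `h418`** = the combined reading r8 `Thm418C` of
[Liu21, Thm. 4.18] on the pinned dictionary `HodgeCM.Model.liuDictionaryPin` at the tree's record rows.  [GR91, Prop. 3.1.1] in the
Π-shape the package consumes is NO LONGER a binder: it is the tree theorem `GRConstruction.gru_shape` (`CompatibleSplittingCM.lean`,
p319353).  KERNEL: the ported head `HodgeCM.Model.periodThmF_picardCM_of_GRU_thm418C` (package `Model/PeriodThmFFace.lean` :179) gives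
`PeriodThmF` of the ported model universe at (hHD, hI, h₁)_holds and `h♭ := cmAbelianVarietyEigenbasisRealised_holds`;
`PortJoin.hc_cm_closed_of_pkg_periodThmF` (row C) transports it to the tree's `PerLFace U_rec` and applies the E term.  HC_CM is NOT proved
unconditionally: `h418` is CITED (reading r8); the as-printed replacement is own-b01's `ClosedAsPrinted`.
[cite: Liu2021, Thm. 4.18 (l. 2232–2245), Thm. 4.18 (1), proof map (4.2)/(TeX eq:cm_albanese l. 2251–2253)]
[cite: GelbartRogawski1991, §3.1 Prop. 3.1.1 p. 455 L1–3] -/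
theorem hc_cm_of_thm418C
    (h418 : ∀ {L : HodgeCM.CMField} {ι₁ : L →+* ℂ} (V : HodgeCM.HermSpace3 L ι₁),
      (NumberField.InfinitePlace.mk ι₁).embedding = ι₁ → ∀ a₀ : HodgeCM.Model.LiuIndex.RealScalar L,
      (HodgeCM.Model.liuDictionaryPin exists_isReal_hodgeModel_holds hodgePQ_independent_of_hodgeModel_holds
          BallQuotient.ballQuotientUniformised_holds
          (cmAbelianVarietyRealised_of_eigenbasis exists_isReal_hodgeModel_holds hodgePQ_independent_of_hodgeModel_holds
            cmAbelianVarietyEigenbasisRealised_holds)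
          Literature.NumberTheory.Transcendental.arapura2012_cor_15_4_6_holds V
          (HodgeCM.Model.LiuIndex.I V (HodgeCM.Model.LiuIndex.repAt a₀) (HodgeCM.Model.LiuIndex.muLiu ι₁ HodgeCM.Model.LiuIndex.GramClass.rep))
          (HodgeCM.Model.LiuIndex.line V (HodgeCM.Model.LiuIndex.repAt a₀) (HodgeCM.Model.LiuIndex.muLiu ι₁ HodgeCM.Model.LiuIndex.GramClass.rep))).Thm418C) :
    HC_CM :=
  hc_cm_closed_of_pkg_periodThmF _
    (HodgeCM.Model.periodThmF_picardCM_of_GRU_thm418C exists_isReal_hodgeModel_holds hodgePQ_independent_of_hodgeModel_holds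
      BallQuotient.ballQuotientUniformised_holds cmAbelianVarietyEigenbasisRealised_holds GRConstruction.gru_shape h418)

end Summit.HodgeConjecture.CorCM.PortJoin

end
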